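import Mathlib
import Literature.NumberTheory.LFunctions.TaoLogChowla

/-!
# `QuadraticDigitPhases` (stmt-QuantumAdvantage-1391) — line `Sketch`, stub `stub_hi`: the HIGH branch

Crux `Summit.QuantumAdvantage.QuantumAdvantage.Theses.MobiusLadder.QuadraticDigitPhases`, line `Sketch`
(lead skeleton `work/QuadraticDigitPhases.lean`). The crux asks that the Liouville function `λ`
(Mathlib's `ArithmeticFunction.liouville`) be `ε`-orthogonal, uniformly, to every quadratic digital phase
`χ_P(N) = (-1)^{P(bits_n N)}` (`P` a polynomial of total degree `≤ 2` over `𝔽₂` in the `n` binary digits).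

This file is the bookkeeping of the HIGH branch: from

* `hBSZ` — the Bourgain–Sarnak–Ziegler criterion (Theorem 2) at a FIXED length `N ≥ N₀(τ)` with an
  `F`-independent threshold (neighbour stub `stub_bszFixedN`), and
* `hD` — far Kátai decay: for every prime bound `B` and `τ > 0` there are `R, s` such that every quadratic
  `P` that is NOT `(R,s)`-low has Kátai pair sums `|Σ_{1 ≤ m ≤ M} χ_P(pm) χ_P(qm)| ≤ τ M` for all odd primes
  `p ≠ q ≤ B` and all `M ∈ [2^n/(2B), 2^n]` (neighbour stub `stub_farKatai`),

we get: for every `ε > 0` there are `R, s` such that eventually in `n` every NOT-`(R,s)`-low quadratic phase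
has `|Σ_{N < 2^n} λ(N) χ_P(N)| ≤ ε 2^n`.

Proof. Choose `τ ≤ min(τ₀, 1/2)` with `2√(τ log(1/τ)) ≤ ε/2` (`exists_tau`: `τ = δ²`,
`log(1/δ²) = 2 log(1/δ) ≤ 2/δ`), `B = ⌈e^{1/τ}⌉`, `N₀` from `hBSZ`, `R, s` from `hD`. For `2^n > N₀ + 2B + 2`
apply `hBSZ` at `N = 2^n - 1` to `F = χ_P` (real, cast to `ℂ`) and `ν = λ`: the primes it uses lie in
`(1/τ, e^{1/τ}]`, so they are `> 2` and `≤ B`, and `M = ⌊(2^n - 1)/max(p,q)⌋` satisfies `M ≤ 2^n ≤ 2BM`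
(`le_two_mul_mul_div`), so `hD` bounds the pair sums. The `N = 0` term of the crux sum vanishes
(`λ 0 = 0`), and the real sum is the complex one (`abs_sum_range_succ_le`). The facts `|λ| ≤ 1` and
multiplicativity of `λ : ArithmeticFunction ℂ` are the tree's
`Literature.NumberTheory.LFunctions.{norm_liouville_complex_le_one, isMultiplicative_liouville_complex}`.
-/

set_option linter.dupNamespace false -- D-0017: single-problem summit ⇒ `QuantumAdvantage.QuantumAdvantage` by design

namespace Summit.QuantumAdvantage.QuantumAdvantage.Theorems.MobiusLadderQuadraticDigitPhasesStubHi

open Finset Filter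
open Literature.NumberTheory.LFunctions (isMultiplicative_liouville_complex norm_liouville_complex_le_one)

/-! ### Small lemmas -/

/-- Choice of the BSZ parameter: for `ε, τ₀ > 0` there is `τ ∈ (0, min(τ₀, 1/2)]` with
`2 √(τ log(1/τ)) ≤ ε / 2`. We take `τ = δ²` with `δ = min(1/2, τ₀, ε²/32)`: then
`log(1/τ) = 2 log(1/δ) ≤ 2/δ`, so `τ log(1/τ) ≤ 2δ ≤ (ε/4)²`. -/
theorem exists_tau (ε τ₀ : ℝ) (hε : 0 < ε) (hτ₀ : 0 < τ₀) :
    ∃ τ : ℝ, 0 < τ ∧ τ ≤ τ₀ ∧ τ ≤ 1 / 2 ∧ 2 * Real.sqrt (τ * Real.log (1 / τ)) ≤ ε / 2 := by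
  set δ : ℝ := min (1 / 2) (min τ₀ (ε ^ 2 / 32)) with hδ_def
  have hδpos : 0 < δ := lt_min (by norm_num) (lt_min hτ₀ (by positivity))
  have hδhalf : δ ≤ 1 / 2 := min_le_left _ _
  have hδτ₀ : δ ≤ τ₀ := (min_le_right _ _).trans (min_le_left _ _)
  have hδε : δ ≤ ε ^ 2 / 32 := (min_le_right _ _).trans (min_le_right _ _)
  refine ⟨δ ^ 2, by positivity, by nlinarith, by nlinarith, ?_⟩
  have h1 : Real.log (1 / δ ^ 2) ≤ 2 / δ := by
    rw [← one_div_pow, Real.log_pow]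
    have := Real.log_le_sub_one_of_pos (show 0 < 1 / δ by positivity)
    push_cast
    rw [div_eq_mul_one_div 2 δ]
    nlinarith
  have h2 : δ ^ 2 * Real.log (1 / δ ^ 2) ≤ (ε / 4) ^ 2 := by
    calc δ ^ 2 * Real.log (1 / δ ^ 2) ≤ δ ^ 2 * (2 / δ) := by gcongr
      _ = 2 * δ := by field_simp
      _ ≤ (ε / 4) ^ 2 := by nlinarith
  have h3 : Real.sqrt (δ ^ 2 * Real.log (1 / δ ^ 2)) ≤ ε / 4 := by
    calc _ ≤ Real.sqrt ((ε / 4) ^ 2) := Real.sqrt_le_sqrt h2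
      _ = ε / 4 := Real.sqrt_sq (by positivity)
  linarith

/-- The Nat-division bookkeeping for `M = ⌊(X - 1)/q⌋`: if `0 < q ≤ B` and `2B + 2 ≤ X` then
`X ≤ 2 · B · M` (indeed `qM ≥ X - q ≥ X - B` and `X ≥ 2B`). -/
theorem le_two_mul_mul_div (X B q : ℕ) (hq : 0 < q) (hqB : q ≤ B) (hX : 2 * B + 2 ≤ X) :
    X ≤ 2 * B * ((X - 1) / q) := by
  have h1 := Nat.div_add_mod (X - 1) q
  have h2 := Nat.mod_lt (X - 1) hq
  have h3 : q * ((X - 1) / q) ≤ B * ((X - 1) / q) := Nat.mul_le_mul_right _ hqB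
  rw [mul_assoc]
  omega

/-- For a REAL sequence `χ` the BSZ pair sum `Σ χ(pm) conj(χ(qm))` is the cast of the real pair sum
`Σ χ(pm) χ(qm)`. -/
theorem pair_sum_cast (χ : ℕ → ℝ) (p q M : ℕ) :
    ∑ m ∈ Icc 1 M, ((χ (p * m) : ℝ) : ℂ) * starRingEnd ℂ ((χ (q * m) : ℝ) : ℂ) =
      ((∑ m ∈ Icc 1 M, χ (p * m) * χ (q * m) : ℝ) : ℂ) := by
  push_cast
  refine Finset.sum_congr rfl fun m _ => ?_
  rw [Complex.conj_ofReal]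

/-- From the complex sum over `1 ≤ m ≤ K` to the real crux sum over `N < K + 1`: the `N = 0` term
vanishes (`λ 0 = 0`) and `|real sum| = ‖its cast to ℂ‖`. -/
theorem abs_sum_range_succ_le (χ : ℕ → ℝ) (K : ℕ) (C : ℝ)
    (h : ‖∑ m ∈ Icc 1 K, (ArithmeticFunction.liouville : ArithmeticFunction ℂ) m * ((χ m : ℝ) : ℂ)‖ ≤ C) :
    |∑ N ∈ range (K + 1), ((ArithmeticFunction.liouville N : ℤ) : ℝ) * χ N| ≤ C := by
  have hsub : Icc 1 K ⊆ range (K + 1) := by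
    intro m hm
    rw [mem_Icc] at hm
    rw [mem_range]
    omega
  have hsum : ∑ N ∈ range (K + 1), ((ArithmeticFunction.liouville N : ℤ) : ℝ) * χ N =
      ∑ m ∈ Icc 1 K, ((ArithmeticFunction.liouville m : ℤ) : ℝ) * χ m := by
    symm
    apply Finset.sum_subset hsub
    intro N hN hN'
    have hN0 : N = 0 := by
      rw [mem_range] at hN
      rw [mem_Icc] at hN'
      omega
    subst hN0
    simp [ArithmeticFunction.map_zero]
  have hcast : ((∑ m ∈ Icc 1 K, ((ArithmeticFunction.liouville m : ℤ) : ℝ) * χ m : ℝ) : ℂ) =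
      ∑ m ∈ Icc 1 K, (ArithmeticFunction.liouville : ArithmeticFunction ℂ) m * ((χ m : ℝ) : ℂ) := by
    push_cast
    refine Finset.sum_congr rfl fun m _ => ?_
    rw [ArithmeticFunction.intCoe_apply]
  rw [hsum, ← Real.norm_eq_abs, ← Complex.norm_real, hcast]
  exact h

/-- The HIGH branch for ONE phase, generically in a real sequence `χ` with `|χ| ≤ 1`: BSZ at the fixed
length `2^n - 1` (hypothesis `hBSZτ`, already specialised to the parameter `τ`) plus the Kátai pair-sum
bound for `χ` at odd primes `≤ B` (hypothesis `hDχ`) give `|Σ_{N<2^n} λ(N) χ(N)| ≤ ε 2^n`, provided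
`2√(τ log(1/τ)) ≤ ε/2`, `1/τ ≥ 2`, `e^{1/τ} ≤ B` and `n ≥ N₀ + 2B + 2`. -/
theorem abs_sum_le_of_bsz_of_pair {τ ε : ℝ} {N₀ B n : ℕ} (χ : ℕ → ℝ) (hχ : ∀ m, |χ m| ≤ 1)
    (hBSZτ : ∀ N : ℕ, N₀ ≤ N →
      ∀ (F : ℕ → ℂ) (ν : ArithmeticFunction ℂ),
        (∀ m, ‖F m‖ ≤ 1) → ν.IsMultiplicative → (∀ m, ‖ν m‖ ≤ 1) →
        (∀ p₁ p₂ : ℕ, p₁.Prime → p₂.Prime → p₁ ≠ p₂ →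
            1 / τ < (p₁ : ℝ) → (p₁ : ℝ) ≤ Real.exp (1 / τ) →
            1 / τ < (p₂ : ℝ) → (p₂ : ℝ) ≤ Real.exp (1 / τ) →
            ‖∑ m ∈ Icc 1 (N / max p₁ p₂), F (p₁ * m) * starRingEnd ℂ (F (p₂ * m))‖ ≤
              τ * ((N / max p₁ p₂ : ℕ) : ℝ)) →
        ‖∑ m ∈ Icc 1 N, ν m * F m‖ ≤ 2 * Real.sqrt (τ * Real.log (1 / τ)) * N)
    (hDχ : ∀ p q : ℕ, p.Prime → q.Prime → p ≠ q → 2 < p → 2 < q → p ≤ B → q ≤ B →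
      ∀ M : ℕ, M ≤ 2 ^ n → 2 ^ n ≤ 2 * B * M →
        |∑ m ∈ Icc 1 M, χ (p * m) * χ (q * m)| ≤ τ * M)
    (hτ : 0 < τ) (hτε : 2 * Real.sqrt (τ * Real.log (1 / τ)) ≤ ε / 2) (hτ2 : τ ≤ 1 / 2)
    (hB : Real.exp (1 / τ) ≤ B) (hn : N₀ + 2 * B + 2 ≤ n) (hε : 0 ≤ ε) :
    |∑ N ∈ range (2 ^ n), ((ArithmeticFunction.liouville N : ℤ) : ℝ) * χ N| ≤ ε * (2 : ℝ) ^ n := by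
  have h2n : n < 2 ^ n := Nat.lt_two_pow_self
  have hK : N₀ ≤ 2 ^ n - 1 := by omega
  have hXB : 2 * B + 2 ≤ 2 ^ n := by omega
  have hτinv : (2 : ℝ) ≤ 1 / τ := by
    rw [le_div_iff₀ hτ]
    linarith
  -- BSZ at `N = 2^n - 1` with `F = χ` and `ν = λ`
  have hmain := hBSZτ (2 ^ n - 1) hK (fun m => ((χ m : ℝ) : ℂ))
    (ArithmeticFunction.liouville : ArithmeticFunction ℂ)
    (fun m => by rw [Complex.norm_real, Real.norm_eq_abs]; exact hχ m)
    isMultiplicative_liouville_complex norm_liouville_complex_le_one (by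
      intro p₁ p₂ hp₁ hp₂ hne h1l h1u h2l h2u
      have hp₁2 : 2 < p₁ := by exact_mod_cast (show (2 : ℝ) < p₁ by linarith)
      have hp₂2 : 2 < p₂ := by exact_mod_cast (show (2 : ℝ) < p₂ by linarith)
      have hp₁B : p₁ ≤ B := by exact_mod_cast (show (p₁ : ℝ) ≤ B from h1u.trans hB)
      have hp₂B : p₂ ≤ B := by exact_mod_cast (show (p₂ : ℝ) ≤ B from h2u.trans hB)
      have hqB : max p₁ p₂ ≤ B := max_le hp₁B hp₂B
      have hqpos : 0 < max p₁ p₂ := lt_max_of_lt_left (by omega)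
      have hM1 : (2 ^ n - 1) / max p₁ p₂ ≤ 2 ^ n := (Nat.div_le_self _ _).trans (Nat.sub_le _ _)
      have hM2 : 2 ^ n ≤ 2 * B * ((2 ^ n - 1) / max p₁ p₂) :=
        le_two_mul_mul_div (2 ^ n) B (max p₁ p₂) hqpos hqB hXB
      have hpair := hDχ p₁ p₂ hp₁ hp₂ hne hp₁2 hp₂2 hp₁B hp₂B ((2 ^ n - 1) / max p₁ p₂) hM1 hM2
      have key : ‖∑ m ∈ Icc 1 ((2 ^ n - 1) / max p₁ p₂),
          ((χ (p₁ * m) : ℝ) : ℂ) * starRingEnd ℂ ((χ (p₂ * m) : ℝ) : ℂ)‖ ≤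
            τ * (((2 ^ n - 1) / max p₁ p₂ : ℕ) : ℝ) := by
        rw [pair_sum_cast χ, Complex.norm_real, Real.norm_eq_abs]
        exact hpair
      exact key)
  have hfin := abs_sum_range_succ_le χ (2 ^ n - 1) _ hmain
  have h2n1 : 2 ^ n - 1 + 1 = 2 ^ n := Nat.sub_add_cancel Nat.one_le_two_pow
  rw [h2n1] at hfin
  refine hfin.trans ?_
  have hcast : ((2 ^ n - 1 : ℕ) : ℝ) ≤ (2 : ℝ) ^ n := by
    calc ((2 ^ n - 1 : ℕ) : ℝ) ≤ ((2 ^ n : ℕ) : ℝ) := Nat.cast_le.mpr (Nat.sub_le _ _)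
      _ = (2 : ℝ) ^ n := by norm_num
  have h2pos : (0 : ℝ) < (2 : ℝ) ^ n := by positivity
  calc 2 * Real.sqrt (τ * Real.log (1 / τ)) * ((2 ^ n - 1 : ℕ) : ℝ)
        ≤ (ε / 2) * (2 : ℝ) ^ n := mul_le_mul hτε hcast (by positivity) (by positivity)
    _ ≤ ε * (2 : ℝ) ^ n := by nlinarith

/-! ### The stub -/

/-- **Stub `stub_hi` (HIGH branch of the crux `QuadraticDigitPhases`, line `Sketch`).**
From the Bourgain–Sarnak–Ziegler criterion at fixed length with an `F`-independent threshold (`hBSZ`,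
neighbour stub `stub_bszFixedN`) and the far Kátai decay of the quadratic digital phases (`hD`, neighbour
stub `stub_farKatai`): for every `ε > 0` there are `R, s` such that, eventually in `n`, every quadratic
`P` over `𝔽₂` in `n` digit variables that is NOT `(R,s)`-low (not an `s`-banded quadratic plus fewer
than `R` products of linear forms on the cube) satisfies
`|Σ_{N < 2^n} λ(N) (-1)^{P(bits_n N)}| ≤ ε · 2^n`.
Proof: `τ` with `2√(τ log(1/τ)) ≤ ε/2`, `τ ≤ min(τ₀, 1/2)` (`exists_tau`); `B = ⌈e^{1/τ}⌉`; `N₀` from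
`hBSZ`, `R, s` from `hD B τ`; then `abs_sum_le_of_bsz_of_pair` for `n ≥ N₀ + 2B + 2`. -/
theorem stub_hi
    (hBSZ : ∃ τ₀ : ℝ, 0 < τ₀ ∧ ∀ τ : ℝ, 0 < τ → τ ≤ τ₀ → ∃ N₀ : ℕ, ∀ N : ℕ, N₀ ≤ N →
      ∀ (F : ℕ → ℂ) (ν : ArithmeticFunction ℂ),
        (∀ m, ‖F m‖ ≤ 1) → ν.IsMultiplicative → (∀ m, ‖ν m‖ ≤ 1) →
        (∀ p₁ p₂ : ℕ, p₁.Prime → p₂.Prime → p₁ ≠ p₂ →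
            1 / τ < (p₁ : ℝ) → (p₁ : ℝ) ≤ Real.exp (1 / τ) →
            1 / τ < (p₂ : ℝ) → (p₂ : ℝ) ≤ Real.exp (1 / τ) →
            ‖∑ m ∈ Icc 1 (N / max p₁ p₂), F (p₁ * m) * starRingEnd ℂ (F (p₂ * m))‖ ≤
              τ * ((N / max p₁ p₂ : ℕ) : ℝ)) →
        ‖∑ m ∈ Icc 1 N, ν m * F m‖ ≤ 2 * Real.sqrt (τ * Real.log (1 / τ)) * N)
    (hD : ∀ B : ℕ, ∀ τ : ℝ, 0 < τ → ∃ R s : ℕ, ∀ n : ℕ, ∀ P : MvPolynomial (Fin n) (ZMod 2),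
      P.totalDegree ≤ 2 →
      ¬ (∃ Q : MvPolynomial (Fin n) (ZMod 2), Q.totalDegree ≤ 2 ∧
          (∀ m ∈ Q.support, ∀ i ∈ m.support, ∀ j ∈ m.support, Nat.dist i j ≤ s) ∧
          ∃ k : ℕ, k < R ∧ ∃ u v : Fin k → Fin n → ZMod 2, ∀ x : Fin n → ZMod 2,
            MvPolynomial.eval x P = MvPolynomial.eval x Q +
              ∑ t : Fin k, (∑ i : Fin n, u t i * x i) * (∑ i : Fin n, v t i * x i)) →
      ∀ p q : ℕ, p.Prime → q.Prime → p ≠ q → 2 < p → 2 < q → p ≤ B → q ≤ B →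
      ∀ M : ℕ, M ≤ 2 ^ n → 2 ^ n ≤ 2 * B * M →
        |∑ m ∈ Icc 1 M,
          (if MvPolynomial.eval (fun i : Fin n => if Nat.testBit (p * m) i then (1 : ZMod 2) else 0) P = 1
            then (-1 : ℝ) else 1) *
          (if MvPolynomial.eval (fun i : Fin n => if Nat.testBit (q * m) i then (1 : ZMod 2) else 0) P = 1
            then (-1 : ℝ) else 1)| ≤ τ * M) :
    ∀ ε : ℝ, 0 < ε → ∃ R s : ℕ, ∀ᶠ n : ℕ in atTop, ∀ P : MvPolynomial (Fin n) (ZMod 2),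
      P.totalDegree ≤ 2 →
      ¬ (∃ Q : MvPolynomial (Fin n) (ZMod 2), Q.totalDegree ≤ 2 ∧
          (∀ m ∈ Q.support, ∀ i ∈ m.support, ∀ j ∈ m.support, Nat.dist i j ≤ s) ∧
          ∃ k : ℕ, k < R ∧ ∃ u v : Fin k → Fin n → ZMod 2, ∀ x : Fin n → ZMod 2,
            MvPolynomial.eval x P = MvPolynomial.eval x Q +
              ∑ t : Fin k, (∑ i : Fin n, u t i * x i) * (∑ i : Fin n, v t i * x i)) →
      |∑ N ∈ range (2 ^ n), ((ArithmeticFunction.liouville N : ℤ) : ℝ) *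
          (if MvPolynomial.eval (fun i : Fin n => if Nat.testBit N i then (1 : ZMod 2) else 0) P = 1
            then (-1 : ℝ) else 1)| ≤ ε * (2 : ℝ) ^ n := by
  intro ε hε
  obtain ⟨τ₀, hτ₀, hBSZ⟩ := hBSZ
  obtain ⟨τ, hτ, hττ₀, hτhalf, hτε⟩ := exists_tau ε τ₀ hε hτ₀
  obtain ⟨N₀, hN₀⟩ := hBSZ τ hτ hττ₀
  obtain ⟨B, hB⟩ : ∃ B : ℕ, Real.exp (1 / τ) ≤ B := ⟨_, Nat.le_ceil _⟩
  obtain ⟨R, s, hRs⟩ := hD B τ hτ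
  refine ⟨R, s, Filter.eventually_atTop.mpr ⟨N₀ + 2 * B + 2, fun n hn P hP hnot => ?_⟩⟩
  exact abs_sum_le_of_bsz_of_pair
    (fun N => if MvPolynomial.eval (fun i : Fin n => if Nat.testBit N i then (1 : ZMod 2) else 0) P = 1
      then (-1 : ℝ) else 1)
    (fun m => by split_ifs <;> simp) hN₀ (hRs n P hP hnot) hτ hτε hτhalf hB hn hε.le

end Summit.QuantumAdvantage.QuantumAdvantage.Theorems.MobiusLadderQuadraticDigitPhasesStubHi
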